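/-
COR-CM (cell pub-hodgecm2, stage 2 of the Hodge ladder) — count-neutral KERNEL COMBINATORICS «the index-two cyclic law», part XX: THE MIXED TWISTS,
I — STRUCTURE (seat prover-pub-hodgecm2-b23-g56-0, binder prover b23, gen 56; claim «INDEX-TWO CYCLIC — THE MIXED TWISTS», HOME/INBOX.md l.26438).
Theorems only (elementary group theory on parts I, VI, IX and seat b23 gen 50ʼs normal-form lemmas, all BY NAME); no definition, no `decide`, no
certificate, no named fact, no `sorry`; `Interfaces.lean` (C1), every E term, B01, `Transposition/*`, `PortJoin/*`, `D2Bridge/*` untouched.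
HONEST FRAMING: `HC_CM` is NOT proved, here or anywhere in the tree; nothing here is a period, a count of record or a headline.
T5: n/a-class (hypothesis binders = the fields of `IndexTwoCyclic.Datum` and `c ∉ ⟨u^{r+1}⟩` — inhabited by `D(ℤ/8) × ℤ/3 = ℤ/24 ⋊₇ ℤ/2`; checker: self).
-/
import Summits.HodgeConjecture.CorCM.Census.IndexTwoCyclicDichotomy
import Summits.HodgeConjecture.CorCM.Census.IndexTwoCyclicNormalForm

/-!
# The index-two cyclic law, XX: the mixed twists, I — the twist element `v = u^{r+1}` and the decomposition `G = Dih × ⟨v⟩`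

THE SETTING of parts I–XIX: an index-two cyclic datum `D` for `(G, c)` (`G ≅ ℤ/2n ⋊_r ℤ/2`, `c = uⁿ`, involution `w`, `w·u = uʳ·w`).  Part IX
split the column by the TWIST ELEMENT **`v := u^{r+1} = (u·w)²`**: `c ∈ ⟨v⟩ ⟺ d₂ = 1 ⟹ μ = φ₂ = β − 1` (part VI); `c ∉ ⟨v⟩ ⟹ d₂ = 0`,
`β − 2 = φ₂ ≤ μ ≤ β − 1`, the exact value known only in the dihedral column `v = 1` (seat b23 gen 48: `μ = β − 2`).  This part describes the
remaining MIXED twists (`c ∉ ⟨v⟩`, `v ≠ 1`) completely as groups — with NO arithmetic of `r` beyond `r² ≡ 1`: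

* §1 **`v` is central** (`w_mul_twist`: `w v w = u^{r(r+1)} = u^{r²+r} = u^{1+r} = v`) and **`v^{r+1} = v²`** (`twist_pow_r_add_one`, same
  computation); `c ∉ ⟨v⟩` forces **`j := orderOf v` ODD** (`odd_orderOf_twist`: an even-order subgroup of the cyclic group `⟨u⟩` contains its unique
  involution `uⁿ = c`, gen 50ʼs `eq_pow_of_mem_zpowers_of_mul_self`), hence `r + 1 ≡ 2 (mod j)` in the sense `v^{r+1} = v²`, and `j ∣ n`.
* §2 **The inverted part `A₋ := ⟨uʲ⟩`**: `w` INVERTS `uʲ` (`w_mul_pow_orderOf_twist`: `w uʲ w = u^{rj} = u^{−j}·vʲ = u^{−j}`), `c ∈ ⟨uʲ⟩`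
  (`j` odd, part VI), `orderOf uʲ = 2n/j`; **`⟨uʲ⟩ ⊓ ⟨v⟩ = ⊥`** (`zpowers_inf_zpowers_twist_eq_bot`: on the intersection `x^{r+1}` is both `1` and
  `x²`, and `⟨v⟩` has odd order) and **`⟨u⟩ = ⟨uʲ⟩·⟨v⟩`** (`exists_pow_mul_twist_pow`: `u = u^{1−(r+1)h}·vʰ` with `2h = j + 1`, and `j ∣ 1 − (r+1)h`).
* §3 **THE DECOMPOSITION** (`exists_normalForm_twist`): every element of `G` is `(uʲ)ᵃ · wᵉ · vᵇ` (`a < 2n/j`, `e < 2`, `b < j`), uniquely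
  (`normalForm_twist_injective`); `⟨uʲ, w⟩` is dihedral of order `4n/j` containing `c`, `⟨v⟩` is central cyclic of odd order `j`, they meet
  trivially and commute: **`G ≅ D_{4n/j} × C_j` with `c` the central involution of the dihedral factor.**  So the mixed twists are EXACTLY the
  dihedral groups with an odd central cyclic factor: `j = 1` is the dihedral column, the smallest mixed row is `D(ℤ/8) × C₃ = (2n, r) = (24, 7)`
  (order `48`), and `|⟨uʲ⟩| = 4` (`n = 2j`) is the octic level `D₄ × C_j` of part XXI.

## References
* [Pohlmann1968] H. Pohlmann, Algebraic cycles on abelian varieties of complex multiplication type, Ann. of Math. 88 (1968), Thm 1.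
* [Milne1999] J. S. Milne, Lefschetz motives and the Tate conjecture, Compositio Math. 117 (1999), Prop. 2.1, p. 54.
-/

namespace Summit.HodgeConjecture.CorCM.Census.IndexTwoCyclic

open Finset
open Summit.HodgeConjecture.CorCM.Prior.AllgGroup.RfwfAllgGroup

noncomputable section

variable {G : Type*} [Group G] [Fintype G] [DecidableEq G] {c : G} {n : ℕ} [NeZero n]
variable (D : Datum G c n)

/-! ## §1 The twist element `v = u^{r+1}`: central, `v^{r+1} = v²`, odd order -/

omit [Fintype G] [DecidableEq G] [NeZero n] in
/-- In `ℤ/2n`: `r·(r+1) = r+1` (from `r² = 1`). [folklore] -/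
theorem r_mul_r_add_one_cast : ((D.r * (D.r + 1) : ℕ) : ZMod (2 * n)) = ((D.r + 1 : ℕ) : ZMod (2 * n)) := by
  have h := D.r_mul_r
  push_cast at h ⊢
  rw [mul_add, mul_one, h, add_comm]

omit [Fintype G] [DecidableEq G] [NeZero n] in
/-- In `ℤ/2n`: `(r+1)·(r+1) = 2·(r+1)`. [folklore] -/
theorem r_add_one_mul_self_cast : (((D.r + 1) * (D.r + 1) : ℕ) : ZMod (2 * n)) = ((2 * (D.r + 1) : ℕ) : ZMod (2 * n)) := by
  have h := D.r_mul_r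
  push_cast at h ⊢
  linear_combination h

omit [Fintype G] [DecidableEq G] [NeZero n] in
/-- **The twist element is central**: `w · u^{r+1} = u^{r+1} · w`. [folklore] -/
theorem w_mul_twist : D.w * D.u ^ (D.r + 1) = D.u ^ (D.r + 1) * D.w := by
  rw [D.w_mul_pow, (D.pow_eq_pow_iff _ _).mpr (r_mul_r_add_one_cast D)]

omit [DecidableEq G] in
/-- **`v = u^{r+1}` commutes with every element of `G`.** [folklore] -/
theorem comm_twist (y : G) : y * D.u ^ (D.r + 1) = D.u ^ (D.r + 1) * y := by
  obtain ⟨i, -, rfl | rfl⟩ := D.exists_pow_or_pow_mul_w y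
  · rw [← pow_add, ← pow_add, add_comm]
  · rw [mul_assoc, w_mul_twist, ← mul_assoc, ← pow_add, add_comm, pow_add, mul_assoc]

omit [Fintype G] [DecidableEq G] [NeZero n] in
/-- **`v^{r+1} = v²`** for `v = u^{r+1}` (`(r+1)² ≡ 2(r+1)`). [folklore] -/
theorem twist_pow_r_add_one : (D.u ^ (D.r + 1)) ^ (D.r + 1) = (D.u ^ (D.r + 1)) ^ 2 := by
  rw [← pow_mul, ← pow_mul, (D.pow_eq_pow_iff _ _).mpr]
  rw [mul_comm (D.r + 1) 2]
  exact r_add_one_mul_self_cast D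

omit [Fintype G] [DecidableEq G] [NeZero n] in
/-- Every power of `v` satisfies `x^{r+1} = x²`. [folklore] -/
theorem pow_r_add_one_eq_sq_of_mem_zpowers_twist {x : G} (hx : x ∈ Subgroup.zpowers (D.u ^ (D.r + 1))) : x ^ (D.r + 1) = x ^ 2 := by
  obtain ⟨k, rfl⟩ := Subgroup.mem_zpowers_iff.mp hx
  set v := D.u ^ (D.r + 1) with hv
  have h1 : (v ^ k) ^ (D.r + 1) = (v ^ (D.r + 1)) ^ k := by
    rw [← zpow_natCast, ← zpow_mul, mul_comm, zpow_mul, zpow_natCast]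
  have h2 : (v ^ k) ^ 2 = (v ^ 2) ^ k := by
    rw [← zpow_natCast, ← zpow_mul, mul_comm, zpow_mul, zpow_natCast]
  rw [h1, h2, hv, twist_pow_r_add_one]

omit [DecidableEq G] [NeZero n] in
/-- **`c ∉ ⟨v⟩` forces `orderOf v` odd**: an even-order element of `⟨u⟩` has the unique involution `uⁿ = c` of `⟨u⟩` among its powers. [folklore] -/
theorem odd_orderOf_twist (h : c ∉ Subgroup.zpowers (D.u ^ (D.r + 1))) : Odd (orderOf (D.u ^ (D.r + 1))) := by
  rcases Nat.even_or_odd (orderOf (D.u ^ (D.r + 1))) with ⟨k, hk⟩ | hodd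
  · exfalso
    set v := D.u ^ (D.r + 1) with hv
    have hk0 : k ≠ 0 := by
      intro hk0
      rw [hk0, add_zero] at hk
      exact (orderOf_pos v).ne' hk
    -- `v^k` is an involution of `⟨u⟩`, hence `= uⁿ = c`
    have hord : orderOf (v ^ k) = 2 := by
      rw [orderOf_pow' v hk0, hk, ← two_mul, Nat.gcd_mul_left_left, Nat.mul_div_cancel _ (Nat.pos_of_ne_zero hk0)]
    have h2 : v ^ k * v ^ k = 1 := by rw [← pow_two, ← hord, pow_orderOf_eq_one]
    have h1 : v ^ k ≠ 1 := by
      intro h1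
      rw [← orderOf_eq_one_iff, hord] at h1
      exact absurd h1 (by norm_num)
    have hmem : v ^ k ∈ Subgroup.zpowers D.u := Subgroup.pow_mem _ (Subgroup.pow_mem _ (Subgroup.mem_zpowers D.u) _) k
    have e := eq_pow_of_mem_zpowers_of_mul_self D.hord hmem h2 h1
    rw [D.hun] at e
    exact h (e ▸ Subgroup.pow_mem _ (Subgroup.mem_zpowers v) k)
  · exact hodd

omit [Fintype G] [DecidableEq G] [NeZero n] in
/-- `orderOf v ∣ 2n`. [folklore] -/
theorem orderOf_twist_dvd : orderOf (D.u ^ (D.r + 1)) ∣ 2 * n := by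
  rw [← D.hord]; exact orderOf_pow_dvd _

omit [DecidableEq G] [NeZero n] in
/-- **`j = orderOf v` divides `n`** when `c ∉ ⟨v⟩` (it is odd and divides `2n`). [folklore] -/
theorem orderOf_twist_dvd_n (h : c ∉ Subgroup.zpowers (D.u ^ (D.r + 1))) : orderOf (D.u ^ (D.r + 1)) ∣ n :=
  (odd_orderOf_twist D h).coprime_two_right.dvd_of_dvd_mul_left (orderOf_twist_dvd D)


/-! ## §2 The inverted part `⟨uʲ⟩`, `j = orderOf v` -/

omit [Fintype G] [DecidableEq G] [NeZero n] in
/-- `u^{(r+1)·j} = 1` for `j = orderOf u^{r+1}`. [folklore] -/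
theorem pow_r_add_one_mul_orderOf_twist : D.u ^ ((D.r + 1) * orderOf (D.u ^ (D.r + 1))) = 1 := by
  rw [pow_mul]; exact pow_orderOf_eq_one _

omit [Fintype G] [DecidableEq G] [NeZero n] in
/-- **`w` inverts `uʲ`** (`j = orderOf u^{r+1}`): `w uʲ w = u^{rj} = u^{−j}`. [folklore] -/
theorem w_mul_pow_orderOf_twist_mul_w : D.w * D.u ^ orderOf (D.u ^ (D.r + 1)) * D.w = (D.u ^ orderOf (D.u ^ (D.r + 1)))⁻¹ := by
  rw [D.w_mul_pow_mul_w]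
  refine eq_inv_of_mul_eq_one_left ?_
  rw [← pow_add, ← Nat.succ_mul, Nat.succ_eq_add_one, pow_r_add_one_mul_orderOf_twist]

omit [Fintype G] [DecidableEq G] [NeZero n] in
/-- `w uʲ = (uʲ)⁻¹ w`. [folklore] -/
theorem w_mul_pow_orderOf_twist : D.w * D.u ^ orderOf (D.u ^ (D.r + 1)) = (D.u ^ orderOf (D.u ^ (D.r + 1)))⁻¹ * D.w := by
  rw [← w_mul_pow_orderOf_twist_mul_w D, mul_assoc, D.hww, mul_one]

omit [DecidableEq G] [NeZero n] in
/-- **`c ∈ ⟨uʲ⟩`** (`j` is odd; part VI). [folklore] -/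
theorem c_mem_zpowers_pow_orderOf_twist (h : c ∉ Subgroup.zpowers (D.u ^ (D.r + 1))) :
    c ∈ Subgroup.zpowers (D.u ^ orderOf (D.u ^ (D.r + 1))) :=
  c_mem_zpowers_pow_of_odd D (odd_orderOf_twist D h)

omit [DecidableEq G] [NeZero n] in
/-- **`orderOf uʲ = 2n/j`.** [folklore] -/
theorem orderOf_pow_orderOf_twist : orderOf (D.u ^ orderOf (D.u ^ (D.r + 1))) = 2 * n / orderOf (D.u ^ (D.r + 1)) := by
  rw [orderOf_pow' D.u (orderOf_pos _).ne', D.hord, Nat.gcd_eq_right (orderOf_twist_dvd D)]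

omit [Fintype G] [DecidableEq G] [NeZero n] in
/-- `(2n/j)·j = 2n`. [folklore] -/
theorem two_mul_div_orderOf_twist_mul : 2 * n / orderOf (D.u ^ (D.r + 1)) * orderOf (D.u ^ (D.r + 1)) = 2 * n :=
  Nat.div_mul_cancel (orderOf_twist_dvd D)

omit [Fintype G] [DecidableEq G] [NeZero n] in
/-- Every power of `uʲ` is killed by the `(r+1)`-power map. [folklore] -/
theorem pow_r_add_one_eq_one_of_mem_zpowers {x : G} (hx : x ∈ Subgroup.zpowers (D.u ^ orderOf (D.u ^ (D.r + 1)))) : x ^ (D.r + 1) = 1 := by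
  obtain ⟨k, rfl⟩ := Subgroup.mem_zpowers_iff.mp hx
  rw [← zpow_natCast, ← zpow_mul, mul_comm, zpow_mul, zpow_natCast, ← pow_mul, mul_comm, pow_r_add_one_mul_orderOf_twist, one_zpow]

omit [DecidableEq G] [NeZero n] in
/-- **`⟨uʲ⟩ ∩ ⟨v⟩ = 1`**: on the intersection `x^{r+1}` is both `1` and `x²`, and `⟨v⟩` has odd order. [folklore] -/
theorem eq_one_of_mem_zpowers_of_mem_zpowers_twist (h : c ∉ Subgroup.zpowers (D.u ^ (D.r + 1))) {x : G}
    (hx : x ∈ Subgroup.zpowers (D.u ^ orderOf (D.u ^ (D.r + 1)))) (hx' : x ∈ Subgroup.zpowers (D.u ^ (D.r + 1))) : x = 1 := by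
  have h2 : x ^ 2 = 1 := by rw [← pow_r_add_one_eq_sq_of_mem_zpowers_twist D hx', pow_r_add_one_eq_one_of_mem_zpowers D hx]
  have hdvd2 : orderOf x ∣ 2 := orderOf_dvd_of_pow_eq_one h2
  have hdvdj : orderOf x ∣ orderOf (D.u ^ (D.r + 1)) := orderOf_dvd_of_mem_zpowers hx'
  have h1 : orderOf x ∣ 1 := by
    rw [← ((odd_orderOf_twist D h).coprime_two_right).gcd_eq_one]
    exact Nat.dvd_gcd hdvdj hdvd2
  exact orderOf_eq_one_iff.mp (Nat.dvd_one.mp h1)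

omit [DecidableEq G] [NeZero n] in
/-- `⟨uʲ⟩ ⊓ ⟨v⟩ = ⊥`. [folklore] -/
theorem zpowers_inf_zpowers_twist_eq_bot (h : c ∉ Subgroup.zpowers (D.u ^ (D.r + 1))) :
    Subgroup.zpowers (D.u ^ orderOf (D.u ^ (D.r + 1))) ⊓ Subgroup.zpowers (D.u ^ (D.r + 1)) = ⊥ := by
  rw [eq_bot_iff]
  intro x hx
  rw [Subgroup.mem_bot]
  exact eq_one_of_mem_zpowers_of_mem_zpowers_twist D h (Subgroup.mem_inf.mp hx).1 (Subgroup.mem_inf.mp hx).2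

omit [Fintype G] [DecidableEq G] [NeZero n] in
/-- **`r + 1 ≡ 2 (mod j)`** (`v^{r+1} = v²`). [folklore] -/
theorem r_add_one_modEq_two : D.r + 1 ≡ 2 [MOD orderOf (D.u ^ (D.r + 1))] :=
  pow_eq_pow_iff_modEq.mp (twist_pow_r_add_one D)

omit [DecidableEq G] [NeZero n] in
/-- **`⟨u⟩ = ⟨uʲ⟩·⟨v⟩`**: `u = (uʲ)ᵃ · vʰ` with `2h = j + 1` (so `(r+1)h ≡ 2h ≡ 1 (mod j)` and `j ∣ 1 − (r+1)h`). [folklore] -/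
theorem exists_u_eq_pow_mul_twist_pow (h : c ∉ Subgroup.zpowers (D.u ^ (D.r + 1))) :
    ∃ a b : ℕ, D.u = (D.u ^ orderOf (D.u ^ (D.r + 1))) ^ a * (D.u ^ (D.r + 1)) ^ b := by
  set j := orderOf (D.u ^ (D.r + 1)) with hj
  obtain ⟨m, hm⟩ := odd_orderOf_twist D h
  -- `(r+1)(m+1) ≡ 1 (mod j)`
  have hmod : (D.r + 1) * (m + 1) ≡ 1 [MOD j] := by
    have h1 : (D.r + 1) * (m + 1) ≡ 2 * (m + 1) [MOD j] := (r_add_one_modEq_two D).mul_right _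
    have h2 : 2 * (m + 1) = j + 1 := by rw [← hj] at hm; omega
    rw [h2] at h1
    exact h1.trans (Nat.add_modEq_left)
  -- so `j ∣ 1 − (r+1)(m+1)` over `ℤ`
  have hdvd : (j : ℤ) ∣ 1 - ((D.r + 1) * (m + 1) : ℕ) := by
    have e := (Nat.modEq_iff_dvd.mp hmod.symm)
    rw [← neg_sub]
    exact (dvd_neg).mpr e
  obtain ⟨q, hq⟩ := hdvd
  -- `u = (uʲ)^q · v^{m+1}` with an integer exponent `q` …
  have hu : D.u = (D.u ^ j) ^ q * (D.u ^ (D.r + 1)) ^ (m + 1) := by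
    have e1 : (D.u ^ j) ^ q = D.u ^ ((j : ℤ) * q) := by rw [zpow_mul, zpow_natCast]
    have e2 : (D.u ^ (D.r + 1)) ^ (m + 1) = D.u ^ (((D.r + 1) * (m + 1) : ℕ) : ℤ) := by rw [zpow_natCast, pow_mul]
    have e : (j : ℤ) * q + (((D.r + 1) * (m + 1) : ℕ) : ℤ) = 1 := by rw [← hq]; ring
    rw [e1, e2, ← zpow_add, e, zpow_one]
  -- … which is a natural power since `G` is finite
  obtain ⟨a, -, ha⟩ := exists_pow_eq_of_mem_zpowers (Subgroup.zpow_mem _ (Subgroup.mem_zpowers (D.u ^ j)) q)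
  exact ⟨a, m + 1, by rw [ha]; exact hu⟩

/-! ## §3 The decomposition `G = ⟨uʲ, w⟩ · ⟨v⟩` -/

omit [DecidableEq G] [NeZero n] in
/-- Every rotation is `(uʲ)ᵃ · vᵇ`. [folklore] -/
theorem exists_pow_eq_pow_mul_twist_pow (h : c ∉ Subgroup.zpowers (D.u ^ (D.r + 1))) (i : ℕ) :
    ∃ a b : ℕ, D.u ^ i = (D.u ^ orderOf (D.u ^ (D.r + 1))) ^ a * (D.u ^ (D.r + 1)) ^ b := by
  obtain ⟨a, b, hab⟩ := exists_u_eq_pow_mul_twist_pow D h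
  refine ⟨a * i, b * i, ?_⟩
  have hcomm : Commute ((D.u ^ orderOf (D.u ^ (D.r + 1))) ^ a) ((D.u ^ (D.r + 1)) ^ b) := by
    rw [← pow_mul, ← pow_mul]; exact Commute.pow_pow_self D.u _ _
  conv_lhs => rw [hab]
  rw [hcomm.mul_pow, ← pow_mul ((D.u ^ orderOf (D.u ^ (D.r + 1)))), ← pow_mul (D.u ^ (D.r + 1))]

omit [DecidableEq G] in
/-- **THE NORMAL FORM**: every element of `G` is `(uʲ)ᵃ · wᵉ · vᵇ` with `e < 2` — `G = ⟨uʲ, w⟩ · ⟨v⟩` with `⟨uʲ, w⟩` dihedral (`w` inverts `uʲ`,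
`c ∈ ⟨uʲ⟩`) and `⟨v⟩` central of odd order meeting `⟨uʲ⟩` trivially. [folklore] -/
theorem exists_normalForm_twist (h : c ∉ Subgroup.zpowers (D.u ^ (D.r + 1))) (g : G) :
    ∃ a e b : ℕ, e < 2 ∧ g = (D.u ^ orderOf (D.u ^ (D.r + 1))) ^ a * D.w ^ e * (D.u ^ (D.r + 1)) ^ b := by
  obtain ⟨i, -, rfl | rfl⟩ := D.exists_pow_or_pow_mul_w g
  · obtain ⟨a, b, hab⟩ := exists_pow_eq_pow_mul_twist_pow D h i
    exact ⟨a, 0, b, by norm_num, by rw [pow_zero, mul_one]; exact hab⟩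
  · obtain ⟨a, b, hab⟩ := exists_pow_eq_pow_mul_twist_pow D h i
    refine ⟨a, 1, b, by norm_num, ?_⟩
    have hc : Commute D.w (D.u ^ (D.r + 1)) := comm_twist D D.w
    rw [hab, pow_one, mul_assoc, mul_assoc, (hc.pow_right b).eq]

omit [DecidableEq G] [NeZero n] in
/-- `w ∉ ⟨uʲ⟩ ⊔ ⟨v⟩ = ⟨u⟩` and the coset element `uʲ·w` is an involution: the factor `⟨uʲ, w⟩` is dihedral with `c` among the rotations.
Recorded as the three relations a `Dihedral.Datum` on it would need. [folklore] -/
theorem dihedral_relations_orderOf_twist (h : c ∉ Subgroup.zpowers (D.u ^ (D.r + 1))) :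
    D.w * D.u ^ orderOf (D.u ^ (D.r + 1)) * D.w = (D.u ^ orderOf (D.u ^ (D.r + 1)))⁻¹ ∧
      c ∈ Subgroup.zpowers (D.u ^ orderOf (D.u ^ (D.r + 1))) ∧ D.w ∉ Subgroup.zpowers (D.u ^ orderOf (D.u ^ (D.r + 1))) :=
  ⟨w_mul_pow_orderOf_twist_mul_w D, c_mem_zpowers_pow_orderOf_twist D h, fun hw =>
    D.hw ((Subgroup.zpowers_le.mpr (Subgroup.pow_mem _ (Subgroup.mem_zpowers D.u) _)) hw)⟩

omit [DecidableEq G] [NeZero n] in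
/-- **The orders multiply**: `|G| = 4n = 2 · (2n/j) · j` — the dihedral factor `⟨uʲ, w⟩` has order `4n/j`, the central factor order `j`. [folklore] -/
theorem card_eq_two_mul_orderOf_mul_orderOf_twist :
    Fintype.card G = 2 * orderOf (D.u ^ orderOf (D.u ^ (D.r + 1))) * orderOf (D.u ^ (D.r + 1)) := by
  have h := (Subgroup.zpowers D.u).card_mul_index
  rw [Nat.card_zpowers, D.hord, D.hindex, Nat.card_eq_fintype_card] at h
  rw [orderOf_pow_orderOf_twist, mul_assoc, two_mul_div_orderOf_twist_mul D]
  omega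

end

end Summit.HodgeConjecture.CorCM.Census.IndexTwoCyclic
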